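/- Copyright: the b2b-balaban cell (near-miss cell 7), T⁴-continuum fan-out, lineage t4-ne7b-p1 (node U5c COUNT
member).  Released under the licence of the surrounding project. -/
import Summits.QuantumFields.BalabanUV.T4Continuum.Support.HistoryGenealogyRealiseChain

/-!
# Genealogy REALISATION — the LEAF-FIRST ORDER EXISTS (H3-(ID), geometric half; first brick of M3b-2): a family of
domains whose touch graph is connected can be LISTED so that each domain touches the union of the later ones
(owner module of row NE7b, lineage `t4-ne7b-p1` gen 40, ruling R-OWNER-40-1; re-open object (α) of `WALL-NE7b-P1.md`
§4 (i)∕(v), `SCOPE-alpha.md` v2 §5 row M3b — PRE-POSITIONING ONLY; sibling of `HistoryGenealogyRealiseChain` ∕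
`HistoryGenealogyRealise`)

Summits-side support leaf of the T⁴-continuum cell (rung (B)+1 on a FINITE torus only; NOT infinite volume, NOT the
mass gap, NOT the Clay statement; NOT a proof of the spine estimate NE7b, which is the cell's OWN estimate, NOT PRINTED
and NOT PROVED).  [folklore] finite graph combinatorics (a greedy enumeration of a connected finite graph) over
`B16MergeGeometry.touchGraph` and `Step.Budget.GConn` (b02's [K] modules) and part 1's `ChainTouch`; Mathlib's
`SimpleGraph.Walk.exists_boundary_dart`; nothing printed is asserted, no `def … : Prop` fact of Bałaban's, no cite-tagged
hypothesis, zero `sorry`.  B16 = [Balaban1989LargeFieldII] p. 386 is a manuscript UNDER AUDIT; the sentence quoted below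
only LOCATES the printed step (certified reading C-B16-6, `t4/T4-XREAD-NE7b-READING.md` V3∕D3).

WHY.  The displayed clause (G-touch) of `HistoryGenealogyRealise.LevelClauses` asks that the constituents of a joined
component be LISTED leaf-first: each constituent's image touches the union of the LATER images (`ChainTouch`) — the
list form of print's «Let us take a maximal tree graph contained in the graph G … an endpoint X … the rest Y» (p. 386),
G being the touch graph of the constituents' images («a pair of domains is a line in G if … the corresponding domains
intersect, or touch each other»), connected «by (1.84)» (b02's `B16MergeGeometry.gconn_touchGraph_of_touchConnected`).
This file proves that such an order EXISTS whenever the touch graph induced on the family is connected — so the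
instantiation M3b-2 may DEFINE the constituent lists of row S13's `ComponentHistory` by choosing one, and (G-touch) is
then discharged by construction.  No tree is needed: the list is grown greedily from any member, PREPENDING at each
step a member outside the current list adjacent to one inside (a boundary dart of a walk leaving the current list), so
the new head touches the union of the tail.  BY-NAME EFFECT ON THE WALL: NONE (pre-positioning for (α)).

WHAT IS PROVED.  `chainTouch_cons` (prepending a domain that touches the union of a nonempty chain keeps the chain);
`exists_adj_out_of_gconn` (BOUNDARY EDGE: in a family `S` with connected induced touch graph, a proper sub-list's
vertex set has a touch-graph edge to a member of `S` outside it); **`exists_chainTouch_list_of_gconn`** (for every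
`k ≤ #S` a duplicate-free list of `k` members of `S` in `ChainTouch` order); **`exists_chainTouch_enum_of_gconn`** (a
duplicate-free ENUMERATION of `S` in `ChainTouch` order); **`exists_chainTouch_enum_of_touchConnected`** (print's
premises of p. 386 in b02's form — a touch-connected `Z` covered by the family, every member meeting `Z` — give the
enumeration, through `gconn_touchGraph_of_touchConnected`).  §2 sanity (`ℤ¹`): the three unit domains `{0}, {1}, {2}`
admit the leaf-first list `[{0}, {1}, {2}]` (each touches the next), checked directly.

HONEST.  Proves nothing of Bałaban's; NE7b NOT proved; spine 0∕9.  HONEST DEPENDENCY (cell): continuum YM on T⁴ ⇐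
BetaPertH ∧ nine spine estimates (0/9 proved); BetaPertH ⇐ (D1) ∧ (D4) ∧ CAP+tail; G-an2-4 gates asym, D1 and NE2/3/4.
This file changes none of it. -/

open Finset
open Literature.MathematicalPhysics.QuantumFieldTheory.Balaban1983to89
open Literature.MathematicalPhysics.QuantumFieldTheory.Balaban1983to89.B13ScaleTransfer
open Literature.MathematicalPhysics.QuantumFieldTheory.Balaban1983to89.B16MergeGeometry
open Literature.MathematicalPhysics.QuantumFieldTheory.Balaban1983to89.Step.Budget

namespace Summit.QuantumFields.BalabanUV.T4Continuum.HistoryGenealogyRealise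

noncomputable section

variable {d : ℕ} {ι : Type*}

/-! ## §1 The greedy leaf-first enumeration of a connected touch graph -/

/-- prepending a domain that touches the union of a NONEMPTY chain keeps the chain [folklore] -/
theorem chainTouch_cons {A : Finset (Pt d)} {M : List (Finset (Pt d))} (hM : M ≠ [])
    (h : ∃ a ∈ A, ∃ c ∈ unionL M, Touch a c) (hc : ChainTouch M) : ChainTouch (A :: M) := by
  match M, hM with
  | B :: L, _ => exact ⟨h, hc⟩

/-- the domain of a listed member lies in the union of the listed domains [folklore] -/
theorem subset_unionL_map (P : ι → Finset (Pt d)) {l : List ι} {i : ι} (hi : i ∈ l) : P i ⊆ unionL (l.map P) :=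
  subset_unionL (List.mem_map.2 ⟨i, hi, rfl⟩)

/-- **BOUNDARY EDGE.**  If the touch graph induced on `S` is connected, `T ⊆ S` contains `x`, and `y ∈ S` lies outside
`T`, then some member of `T` is adjacent in the touch graph to some member of `S` outside `T` (a boundary dart of a
walk from `x` to `y` inside `S`). [folklore] -/
theorem exists_adj_out_of_gconn (P : ι → Finset (Pt d)) {S T : Finset ι} (hG : GConn (touchGraph P) S)
    (hTS : T ⊆ S) {x y : ι} (hx : x ∈ T) (hyS : y ∈ S) (hyT : y ∉ T) :
    ∃ u ∈ T, ∃ v ∈ S, v ∉ T ∧ (touchGraph P).Adj u v := by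
  have hr : ((touchGraph P).induce (S : Set ι)).Reachable ⟨x, Finset.mem_coe.2 (hTS hx)⟩ ⟨y, Finset.mem_coe.2 hyS⟩ :=
    hG.preconnected _ _
  obtain ⟨p⟩ := hr
  obtain ⟨e, -, hfst, hsnd⟩ := p.exists_boundary_dart {w | w.1 ∈ T} hx hyT
  exact ⟨e.fst.1, hfst, e.snd.1, Finset.mem_coe.1 e.snd.2, hsnd, SimpleGraph.induce_adj.1 e.adj⟩

variable [DecidableEq ι]

/-- **GREEDY LEAF-FIRST LISTS.**  If the touch graph induced on `S` is connected, then for every `k ≤ #S` there is a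
duplicate-free list of `k` members of `S` in `ChainTouch` order (each listed domain touches the union of the later
ones): grow the list by PREPENDING a member outside it adjacent to a member inside it. [folklore] -/
theorem exists_chainTouch_list_of_gconn (P : ι → Finset (Pt d)) {S : Finset ι} (hG : GConn (touchGraph P) S) :
    ∀ k, k ≤ S.card → ∃ l : List ι, l.Nodup ∧ (∀ i ∈ l, i ∈ S) ∧ l.length = k ∧ ChainTouch (l.map P)
  | 0, _ => ⟨[], List.nodup_nil, by simp, rfl, by simp⟩
  | k + 1, hk => by
      obtain ⟨l, hnd, hsub, hlen, hct⟩ := exists_chainTouch_list_of_gconn P hG k (Nat.le_of_succ_le hk)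
      match l, hnd, hsub, hlen, hct with
      | [], _, _, hlen, _ =>
          -- the first member: any vertex of the (non-empty) connected family
          obtain ⟨v, hv⟩ := gconn_nonempty _ _ hG
          simp only [List.length_nil] at hlen
          subst hlen
          exact ⟨[v], List.nodup_singleton v, by simpa using hv, rfl, by simp⟩
      | u :: rest, hnd, hsub, hlen, hct =>
          set T : Finset ι := (u :: rest).toFinset with hT
          have hTS : T ⊆ S := fun i hi => hsub i (List.mem_toFinset.1 hi)
          have hcard : T.card = k := by rw [hT, List.toFinset_card_of_nodup hnd]; exact hlen
          obtain ⟨y, hyS, hyT⟩ := Finset.exists_mem_notMem_of_card_lt_card (s := T) (t := S) (by omega)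
          obtain ⟨u', hu'T, v, hvS, hvT, hadj⟩ :=
            exists_adj_out_of_gconn P hG hTS (x := u) (List.mem_toFinset.2 (by simp)) hyS hyT
          obtain ⟨-, a, ha, c, hc, hac⟩ := (touchGraph_adj P u' v).1 hadj
          have hv_notin : v ∉ u :: rest := fun h => hvT (List.mem_toFinset.2 h)
          refine ⟨v :: u :: rest, List.nodup_cons.2 ⟨hv_notin, hnd⟩, ?_, by simp [hlen], ?_⟩
          · intro i hi
            rcases List.mem_cons.1 hi with rfl | hi
            · exact hvS
            · exact hsub i hi
          · rw [List.map_cons]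
            refine chainTouch_cons (by simp) ⟨c, hc, a, ?_, hac.symm⟩ hct
            exact subset_unionL_map P (List.mem_toFinset.1 hu'T) ha

/-- **THE LEAF-FIRST ENUMERATION EXISTS**: a family `S` with connected induced touch graph has a duplicate-free
enumeration in `ChainTouch` order. [folklore] -/
theorem exists_chainTouch_enum_of_gconn (P : ι → Finset (Pt d)) {S : Finset ι} (hG : GConn (touchGraph P) S) :
    ∃ l : List ι, l.Nodup ∧ l.toFinset = S ∧ ChainTouch (l.map P) := by
  obtain ⟨l, hnd, hsub, hlen, hct⟩ := exists_chainTouch_list_of_gconn P hG S.card le_rfl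
  refine ⟨l, hnd, Finset.eq_of_subset_of_card_le (fun i hi => hsub i (List.mem_toFinset.1 hi)) ?_, hct⟩
  rw [List.toFinset_card_of_nodup hnd, hlen]

/-- **PRINT'S PREMISES GIVE THE ORDER** (p. 386 in b02's form): a TOUCH-CONNECTED `Z` covered by the domains of a
non-empty family `S` every member of which MEETS `Z` ⟹ `S` has a duplicate-free enumeration in `ChainTouch` order
(`gconn_touchGraph_of_touchConnected` + the greedy enumeration). [folklore] -/
theorem exists_chainTouch_enum_of_touchConnected (P : ι → Finset (Pt d)) {S : Finset ι} {Z : Finset (Pt d)}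
    (hZ : TouchConnected Z) (hZS : Z ⊆ fam P S) (hmeet : ∀ i ∈ S, ∃ z ∈ Z, z ∈ P i) (hS : S.Nonempty) :
    ∃ l : List ι, l.Nodup ∧ l.toFinset = S ∧ ChainTouch (l.map P) :=
  exists_chainTouch_enum_of_gconn P (gconn_touchGraph_of_touchConnected P hZ hZS hmeet hS)

/-! ## §2 Sanity (`ℤ¹`): three unit domains in a row, listed left to right, are in `ChainTouch` order -/

namespace SanityOrder

open B16MergeGeometry.OneDim

/-- consecutive cubes of `ℤ¹` touch [folklore] -/
theorem touch_pt_succ (k : ℤ) : Touch (pt k) (pt (k + 1)) := fun _ => by simp only [pt]; omega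

/-- `[{0}, {1}, {2}]` is a leaf-first list: `{0}` touches `{1} ∪ {2} ∪ ∅`, `{1}` touches `{2} ∪ ∅` [folklore] -/
example : ChainTouch ([{pt 0}, {pt 1}, {pt 2}] : List (Finset (Pt 1))) := by
  refine ⟨⟨pt 0, by simp, pt 1, by simp, touch_pt_succ 0⟩, ⟨pt 1, by simp, pt 2, by simp, ?_⟩, trivial⟩
  simpa using touch_pt_succ 1

end SanityOrder

end

end Summit.QuantumFields.BalabanUV.T4Continuum.HistoryGenealogyRealise
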